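import Summits.Ventures.HodgeRepro2.T5SU11SphericalIntegral
import Summits.Ventures.HodgeRepro2.T5SU11CoefficientL2

/-!
# The weight-3 coefficient integral in Cartan coordinates: `∫_G (1 - |g·0|²)³ dν = 2π ∫_0^∞ sinh t cosh⁻⁵ t dt = π/2`

`T5SU11CoefficientL2` computes `∫_G coeffSq dν = π/2` for `coeffSq g = (1 - |g·0|²)³` (the square of
the normalised weight-3 lowest-weight coefficient) through the disc. Here the same integral is
computed through the SPHERICAL formula of `T5SU11SphericalIntegral`: `coeffSq` is bi-`K`-invariant
(`coeffSq_rot_mul_rot`: `|(rot u · g · rot v)·0| = |g·0|`), takes the value `cosh⁻⁶ t` on `a_t`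
(`coeffSq_hyp`: `1 - tanh² t = cosh⁻² t`), so
**`∫_G coeffSq dν = 2π ∫_0^∞ sinh t · cosh⁻⁵ t dt`** (`integral_coeffSq_nu_cartan`), and the improper
integral is `1/4` by the fundamental theorem of calculus on `[0, ∞)` with the antiderivative
`-cosh⁻⁴ t / 4` (`integral_sinh_mul_inv_cosh_pow`: `∫_0^∞ sinh t · cosh^{-(2n+1)} t dt = 1/(2n)` for
`n ≥ 1`), giving **`∫_G coeffSq dν = π/2`** again (`integral_coeffSq_nu_cartan'`) — the disc and the
Cartan computations of the weight-3 formal-degree integral agree in kernel. Nothing is claimed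
about (N).

Blind lane: Mathlib + the HodgeRepro2 prefix only; no sorry; axioms ⊆ {propext, Classical.choice,
Quot.sound}.
-/

namespace Summit.Ventures.HodgeRepro2.T5SU11CoeffSqCartan

open MeasureTheory MeasureTheory.Measure Metric Set Filter Topology Complex
open T5PoincareDensity T5PoincareMeasure T5SU11Unimodular T5SU11Fibration T5SU11FibrationHaar
  T5SU11FibrationCartan T5HaarCircle T5SU11Cartan T5SU11OneParameter T5BergmanCoefficient
  T5SU11CoefficientL2 T5SU11SphericalIntegral
open scoped ENNReal NNReal Real

/-! ### `coeffSq` is bi-`K`-invariant and equals `cosh⁻⁶ t` on `a_t` -/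

/-- `(rot u · g)·0 = u² · (g·0)`. -/
lemma orbit_rot_mul (u : Circle) (g : SU11) : orbit (rot u * g) = (u : ℂ) ^ 2 * orbit g := by
  rw [orbit_mul, coe_rot, mobius_su11, map_zero, zero_mul, zero_add, add_zero]
  have h1 : (u : ℂ) * (starRingEnd ℂ) (u : ℂ) = 1 := by
    rw [Complex.mul_conj, Complex.normSq_eq_norm_sq, Circle.norm_coe, one_pow, Complex.ofReal_one]
  have h2 : (starRingEnd ℂ) (u : ℂ) ≠ 0 := (map_ne_zero _).mpr (Circle.coe_ne_zero u)
  rw [div_eq_iff h2]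
  linear_combination (-(u : ℂ) * orbit g) * h1

/-- `|(rot u · g)·0| = |g·0|`. -/
lemma norm_orbit_rot_mul (u : Circle) (g : SU11) : ‖orbit (rot u * g)‖ = ‖orbit g‖ := by
  rw [orbit_rot_mul, norm_mul, norm_pow, Circle.norm_coe, one_pow, one_mul]

/-- `(g · rot v)·0 = g·0`. -/
lemma orbit_mul_rot (g : SU11) (v : Circle) : orbit (g * rot v) = orbit g := by
  rw [orbit_mul, orbit_rot]
  rfl

/-- **`coeffSq` is bi-`K`-invariant**: `coeffSq (rot u · g · rot v) = coeffSq g`. -/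
theorem coeffSq_rot_mul_rot (u v : Circle) (g : SU11) : coeffSq (rot u * g * rot v) = coeffSq g := by
  unfold coeffSq
  rw [mul_assoc, norm_orbit_rot_mul, orbit_mul_rot]

/-- `1 - tanh² t = cosh⁻² t`. -/
lemma one_sub_tanh_sq (t : ℝ) : 1 - Real.tanh t ^ 2 = (Real.cosh t)⁻¹ ^ 2 := by
  have hc : Real.cosh t ≠ 0 := (Real.cosh_pos t).ne'
  rw [Real.tanh_eq_sinh_div_cosh, div_pow, one_sub_div (pow_ne_zero 2 hc),
    show Real.cosh t ^ 2 - Real.sinh t ^ 2 = 1 by linear_combination Real.cosh_sq t, inv_pow, one_div]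

/-- **`coeffSq (a_t) = cosh⁻⁶ t`**. -/
theorem coeffSq_hyp (t : ℝ) : coeffSq (hyp t) = (Real.cosh t)⁻¹ ^ 6 := by
  unfold coeffSq
  rw [orbit_hyp, Complex.norm_real, Real.norm_eq_abs, sq_abs, one_sub_tanh_sq, ← pow_mul]

/-! ### The improper integral `∫_0^∞ sinh t · cosh^{-(2n+1)} t dt = 1/(2n)` -/

/-- `cosh t → ∞` as `t → ∞` (`cosh t ≥ e^t / 2`). -/
lemma tendsto_cosh_atTop : Tendsto Real.cosh atTop atTop := by
  refine tendsto_atTop_mono (fun t => ?_) (Real.tendsto_exp_atTop.atTop_div_const two_pos)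
  rw [Real.cosh_eq]
  linarith [Real.exp_pos (-t)]

/-- **`∫_0^∞ sinh t · cosh^{-(2n+1)} t dt = 1/(2n)`** for `n ≥ 1` (antiderivative `-cosh^{-2n} t / (2n)`). -/
theorem integral_sinh_mul_inv_cosh_pow (n : ℕ) (hn : 1 ≤ n) :
    ∫ t in Ioi (0 : ℝ), Real.sinh t * (Real.cosh t)⁻¹ ^ (2 * n + 1) = 1 / (2 * n) := by
  obtain ⟨m, rfl⟩ : ∃ m, n = m + 1 := ⟨n - 1, by omega⟩
  set F : ℝ → ℝ := fun t => -(1 / (2 * ((m + 1 : ℕ) : ℝ))) * ((Real.cosh t)⁻¹ ^ (2 * (m + 1))) with hF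
  have hc : ∀ t, Real.cosh t ≠ 0 := fun t => (Real.cosh_pos t).ne'
  have hderiv : ∀ t, HasDerivAt F (Real.sinh t * (Real.cosh t)⁻¹ ^ (2 * (m + 1) + 1)) t := by
    intro t
    have h1 : HasDerivAt (fun t => (Real.cosh t)⁻¹) (-(Real.sinh t) / Real.cosh t ^ 2) t :=
      (Real.hasDerivAt_cosh t).inv (hc t)
    have h2 := (h1.pow (2 * (m + 1))).const_mul (-(1 / (2 * ((m + 1 : ℕ) : ℝ))))
    refine h2.congr_deriv ?_
    have hm : (2 * (m + 1) : ℕ) - 1 = 2 * m + 1 := by omega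
    rw [hm]
    have hct : Real.cosh t ≠ 0 := hc t
    have hm' : ((m + 1 : ℕ) : ℝ) ≠ 0 := by positivity
    simp only [inv_pow]
    field_simp
    push_cast
    ring
  have hnonneg : ∀ t ∈ Ioi (0 : ℝ), 0 ≤ Real.sinh t * (Real.cosh t)⁻¹ ^ (2 * (m + 1) + 1) := by
    intro t ht
    exact mul_nonneg (Real.sinh_nonneg_iff.mpr (le_of_lt ht)) (pow_nonneg (inv_nonneg.mpr (Real.cosh_pos t).le) _)
  have hlim : Tendsto F atTop (𝓝 0) := by
    have h1 : Tendsto (fun t => (Real.cosh t)⁻¹) atTop (𝓝 0) := tendsto_cosh_atTop.inv_tendsto_atTop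
    have h2 : Tendsto (fun t => (Real.cosh t)⁻¹ ^ (2 * (m + 1))) atTop (𝓝 (0 ^ (2 * (m + 1)))) :=
      h1.pow _
    rw [zero_pow (by omega)] at h2
    have h3 := h2.const_mul (-(1 / (2 * ((m + 1 : ℕ) : ℝ))))
    rwa [mul_zero] at h3
  have hcont : ContinuousWithinAt F (Ici 0) 0 := (hderiv 0).continuousAt.continuousWithinAt
  rw [integral_Ioi_of_hasDerivAt_of_nonneg hcont (fun t _ => hderiv t) hnonneg hlim, hF]
  simp only [Real.cosh_zero, inv_one, one_pow, mul_one, zero_sub, neg_neg]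

/-! ### The Cartan computation of `∫_G coeffSq dν` -/

section measure

variable [MeasurableSpace Circle] [BorelSpace Circle]

/-- **`∫_G coeffSq dν = 2π ∫_0^∞ sinh t · cosh⁻⁵ t dt`** (the spherical formula applied to the
bi-`K`-invariant `coeffSq`). -/
theorem integral_coeffSq_nu_cartan :
    ∫ g, coeffSq g ∂(nu haarCircle) =
      (2 * π) • ∫ t in Ioi (0 : ℝ), Real.sinh t * (Real.cosh t)⁻¹ ^ 5 := by
  rw [integral_nu_biRotInvariant (integrable_coeffSq _) coeffSq_rot_mul_rot]
  congr 1
  refine setIntegral_congr_fun measurableSet_Ioi fun t _ => ?_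
  rw [coeffSq_hyp, smul_eq_mul]
  have hc : Real.cosh t ≠ 0 := (Real.cosh_pos t).ne'
  field_simp

/-- **`∫_G coeffSq dν = π/2` by the Cartan computation** — agreeing with the disc computation
`T5SU11CoefficientL2.integral_coeffSq_nu`. -/
theorem integral_coeffSq_nu_cartan' : ∫ g, coeffSq g ∂(nu haarCircle) = π / 2 := by
  rw [integral_coeffSq_nu_cartan,
    show (5 : ℕ) = 2 * 2 + 1 by norm_num, integral_sinh_mul_inv_cosh_pow 2 (by norm_num), smul_eq_mul]
  norm_num
  ring

/-- The two computations agree (a kernel consistency check of rows `T5SU11CoefficientL2` and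
`T5SU11SphericalIntegral`): the Cartan value equals the disc value. -/
theorem cartan_eq_disc :
    (2 * π) • ∫ t in Ioi (0 : ℝ), Real.sinh t * (Real.cosh t)⁻¹ ^ 5 = π / 2 := by
  rw [← integral_coeffSq_nu_cartan, integral_coeffSq_nu]

end measure

end Summit.Ventures.HodgeRepro2.T5SU11CoeffSqCartan
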